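import Mathlib.RingTheory.DedekindDomain.AdicValuation
import Mathlib.RingTheory.LocalRing.ResidueField.Ideal
import Mathlib.RingTheory.Localization.AtPrime.Basic
import Mathlib.NumberTheory.NumberField.Basic
import Mathlib.NumberTheory.NumberField.Ideal.Basic
import Mathlib.AlgebraicGeometry.Morphisms.Smooth
import Mathlib.AlgebraicGeometry.Morphisms.Proper
import Mathlib.AlgebraicGeometry.SpreadingOut
import Literature.AlgebraicGeometry.Motives.BaseChange
import Literature.AlgebraicGeometry.Motives.Varieties
import Literature.NumberTheory.GaloisRepresentations.IntegralGaloisAction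
import HarnessLib

-- provenance: harness21/H21/H21/Prelude/MotiveL/GoodReduction.lean @ 315230b (interim HEAD d8f2665); M5 mechanical rewrite
/-!
# Integral models and good reduction (trunk T-MOTIVE / MotiveL, item C6)

Informal content. Let `R` be a domain with fraction field `K` and `X` a `K`-scheme. An *integral
model* of `X` over `R` is an `R`-scheme `𝒳` together with an isomorphism of its generic fibre
`𝒳 ×_R K` with `X`. The model has *good reduction* if `𝒳 → Spec R` is smooth and proper; its
*reduction* modulo a maximal ideal `𝔪` is the special fibre `𝒳 ×_R (R ⧸ 𝔪)`.
For a number field `K` and a finite place `v` (a `HeightOneSpectrum (𝓞 K)`), `X` has *good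
reduction at `v`* if it admits a smooth proper model over the local ring `𝓞_{K,v}`; every smooth
projective variety has good reduction outside a finite set of places ("spreading out").

Sources: J.-P. Serre, J. Tate, *Good reduction of abelian varieties*, Ann. of Math. 88 (1968), §1;
SGA 1, Exp. X; EGA IV₃ §8.10.5 and IV₄ §17 (spreading out of smooth proper morphisms);
Stacks Project Tags 01W7, 02V4, 0E0N.

Design choices.
* Everything about the local ring and residue field at `v` is a Mathlib object (nothing is
  redefined): the local ring is `IsDedekindDomain.HeightOneSpectrum.valuationSubringAtPrime K v`
  (a `ValuationSubring K`, with Mathlib instances `Algebra (𝓞 K)`, `IsLocalization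
  v.asIdeal.primeCompl`, `IsDedekindDomain`, `IsLocalRing`, `IsFractionRing _ K`), and the
  residue field is `v.asIdeal.ResidueField` (`Ideal.ResidueField`; `Field` and `Finite` by
  `inferInstance`). We only supply the comparison `residueFieldEquiv` between the residue field of
  the local ring and `v.asIdeal.ResidueField`, built from `IsLocalization.algEquiv` and
  `IsLocalRing.ResidueField.mapEquiv`, and the cardinality lemma `natCard_residueField`
  (via the accepted G09 `HeightOneSpectrum.residueCard`).
* Base change uses the accepted `Literature.AlgebraicGeometry.Motives.baseChange` (along an algebra) and `Literature.AlgebraicGeometry.Motives.baseChangeHom` (along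
  a ring homomorphism), i.e. Mathlib's `Over.pullback`; smoothness and properness of reductions
  are REAL consequences of Mathlib's `MorphismProperty.IsStableUnderBaseChange` instances
  (`MorphismProperty.baseChange_obj`).
* `IntegralModel.IsSmoothProper n` is a `def … : Prop` (a conjunction), following the outline;
  `HasGoodReductionAt X n v` quantifies existentially over integral models over `𝓞_{K,v}`.
  `HasPotentialGoodReductionAt` asks for a finite extension `L/K` (a number field `L : Type` with
  `Algebra K L`) such that `X_L` has good reduction at every place of `L` above `v`
  (Serre–Tate 1968, §1, "potential good reduction").
* Mathlib has no `IntegralModel`, `HasGoodReduction*` or `reduction` of schemes (checked by grep: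
  only `AlgebraicGeometry/SpreadingOut.lean`, which treats spreading out of *morphisms* between
  schemes of finite presentation, and `WeierstrassCurve` reduction for elliptic curves).
-/

universe u

open CategoryTheory AlgebraicGeometry Limits IsDedekindDomain

noncomputable section

namespace Literature.AlgebraicGeometry.Motives

/-! ### Integral models over a domain -/

section IntegralModel

/- The outline works with `[IsDomain R] [IsFractionRing R K]`; neither hypothesis is used by any
definition below, so (Mathlib generality) we only assume `[Algebra R K]` and record the intended
case `K = Frac R` in the docstrings. -/
variable (R K : Type u) [CommRing R] [Field K] [Algebra R K]

/-- An *integral model* over `R` of a scheme `X` over `K` (intended case: `R` a domain and `K`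
its fraction field, e.g. `R = 𝓞_{K,v}`): an `R`-scheme `total` together with an isomorphism of
`K`-schemes between its generic fibre `total ×_{Spec R} Spec K` and `X`
(Serre–Tate 1968, §1; EGA IV₃ 8.8). Only `[Algebra R K]` is needed to state this. [cite: SerreTate1968, §1] -/
structure IntegralModel (X : SchemeOver K) where
  /-- The total space `𝒳 → Spec R` of the model. -/
  total : SchemeOver R
  /-- The identification of the generic fibre `𝒳 ×_R K` with `X`. -/
  genericIso : (baseChange R K).obj total ≅ X

variable {R K}

namespace IntegralModel

variable {X : SchemeOver K} (𝒳 : IntegralModel R K X)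

/-- An integral model `𝒳` is *smooth and proper of relative dimension `n`* if its structure
morphism `𝒳 → Spec R` is smooth of relative dimension `n` and proper; this is the condition
defining *good reduction* (Serre–Tate 1968, §1; SGA 1 X). [cite: SerreTate1968, §1] -/
def IsSmoothProper (n : ℕ) : Prop :=
  SmoothOfRelativeDimension n 𝒳.total.hom ∧ IsProper 𝒳.total.hom

/-- The *reduction* of an integral model modulo an ideal `𝔪` of `R`: the fibre
`𝒳 ×_{Spec R} Spec (R ⧸ 𝔪)` over the closed subscheme `Spec (R ⧸ 𝔪) ⊆ Spec R`, as a scheme over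
`R ⧸ 𝔪`. The intended case is `𝔪` maximal, when this is the *special fibre* over the residue
field `R ⧸ 𝔪`; the construction (a base change) needs no hypothesis on `𝔪`, so, following
Mathlib generality, none is assumed (Serre–Tate 1968, §1; Hartshorne II.3, "fibre"). [cite: SerreTate1968, §1] -/
def reduction (𝔪 : Ideal R) : SchemeOver (R ⧸ 𝔪) :=
  (baseChange R (R ⧸ 𝔪)).obj 𝒳.total

/-- The reduction of a proper model is proper over `R ⧸ 𝔪`: properness is stable under
base change (Hartshorne II.4.8(c); Stacks 01W4; Mathlib `IsProper.isStableUnderBaseChange`). [folklore] -/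
instance isProper_reduction (𝔪 : Ideal R) [IsProper 𝒳.total.hom] :
    IsProper (𝒳.reduction 𝔪).hom :=
  MorphismProperty.baseChange_obj _ _ ‹_›

/-- The reduction of a model smooth of relative dimension `n` is smooth of relative dimension `n`
over `R ⧸ 𝔪`: smoothness is stable under base change (Hartshorne III.10.1(b);
Stacks 01VB; Mathlib `smoothOfRelativeDimension_isStableUnderBaseChange`). [folklore] -/
instance smooth_reduction (n : ℕ) (𝔪 : Ideal R)
    [SmoothOfRelativeDimension n 𝒳.total.hom] :
    SmoothOfRelativeDimension n (𝒳.reduction 𝔪).hom :=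
  haveI := smoothOfRelativeDimension_isStableUnderBaseChange (n := n)
  MorphismProperty.baseChange_obj _ _ ‹_›

/-- The reduction of a smooth proper model of relative dimension `n` modulo `𝔪` is smooth of
relative dimension `n` and proper over `R ⧸ 𝔪` (in particular over the residue field when `𝔪`
is maximal; Serre–Tate 1968, §1). [cite: SerreTate1968, §1] -/
theorem IsSmoothProper.reduction {n : ℕ} (h : 𝒳.IsSmoothProper n) (𝔪 : Ideal R) :
    SmoothOfRelativeDimension n (𝒳.reduction 𝔪).hom ∧ IsProper (𝒳.reduction 𝔪).hom :=
  haveI := h.1; haveI := h.2; ⟨inferInstance, inferInstance⟩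

end IntegralModel

end IntegralModel

/-! ### Number fields: local rings, residue fields and reduction at a finite place -/

section NumberField

open scoped NumberField

open IsDedekindDomain.HeightOneSpectrum

variable {K : Type} [Field K] [NumberField K] (v : HeightOneSpectrum (𝓞 K))

/-- The residue field of the local ring `𝓞_{K,v} = valuationSubringAtPrime K v` at a finite place
`v` is canonically isomorphic to Mathlib's residue field `κ(v) = v.asIdeal.ResidueField` of the
prime `v` (both are localisations of `𝓞 K` at `v`; the isomorphism is
`IsLocalRing.ResidueField.mapEquiv` of `IsLocalization.algEquiv`).
Ref: Neukirch, *Algebraic Number Theory*, Ch. I §11; Serre–Tate 1968, §1. [cite: SerreTate1968, §1] -/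
def residueFieldEquiv :
    IsLocalRing.ResidueField (valuationSubringAtPrime K v) ≃+* v.asIdeal.ResidueField :=
  IsLocalRing.ResidueField.mapEquiv
    (IsLocalization.algEquiv v.asIdeal.primeCompl (Localization.AtPrime v.asIdeal)
      (valuationSubringAtPrime K v)).symm.toRingEquiv

/-- The residue field `κ(v)` is finite (Mathlib instances, `NumberField/Ideal/Basic` and
`ResidueField/Ideal`). -/
example : Finite v.asIdeal.ResidueField := inferInstance

/-- The residue field `κ(v)` of a finite place has `q_v = N v` elements:
`Nat.card κ(v) = v.residueCard` (G09 `residueCard_eq_card_quotient` and Mathlib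
`Ideal.bijective_algebraMap_quotient_residueField`).
Ref: Neukirch, *Algebraic Number Theory*, Ch. I §6, (6.1). [folklore] -/
theorem natCard_residueField : Nat.card v.asIdeal.ResidueField = v.residueCard := by
  rw [residueCard_eq_card_quotient]
  exact (Nat.card_congr (Equiv.ofBijective _
    (Ideal.bijective_algebraMap_quotient_residueField v.asIdeal))).symm

/-- The reduction map `𝓞_{K,v} → κ(v)`: the residue map of the local ring followed by
`residueFieldEquiv` (Serre–Tate 1968, §1). [cite: SerreTate1968, §1] -/
def residueAt : valuationSubringAtPrime K v →+* v.asIdeal.ResidueField :=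
  (residueFieldEquiv v).toRingHom.comp (IsLocalRing.residue _)

/-- `residueAt v` is surjective (the residue map of a local ring is). [folklore] -/
theorem residueAt_surjective : Function.Surjective (residueAt v) :=
  (residueFieldEquiv v).surjective.comp IsLocalRing.residue_surjective

namespace IntegralModel

variable {v} {X : SchemeOver K} (𝒳 : IntegralModel (valuationSubringAtPrime K v) K X)

/-- The *reduction at `v`* of an integral model `𝒳` over `𝓞_{K,v}` of a `K`-scheme `X`: the
special fibre `𝒳 ×_{𝓞_{K,v}} κ(v)` as a scheme over the residue field `κ(v) =
v.asIdeal.ResidueField`, i.e. base change along `residueAt v` (Serre–Tate 1968, §1). [cite: SerreTate1968, §1] -/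
def reductionAt : SchemeOver v.asIdeal.ResidueField :=
  (baseChangeHom (residueAt v)).obj 𝒳.total

/-- `𝒳.reductionAt` is `(baseChangeHom (residueAt v)).obj 𝒳.total` (by `rfl`). [folklore] -/
theorem reductionAt_eq : 𝒳.reductionAt = (baseChangeHom (residueAt v)).obj 𝒳.total := rfl

/-- The reduction at `v` of a proper model is proper over `κ(v)` (base change;
Hartshorne II.4.8(c); Stacks 01W4). [folklore] -/
instance isProper_reductionAt [IsProper 𝒳.total.hom] : IsProper 𝒳.reductionAt.hom :=
  MorphismProperty.baseChange_obj _ _ ‹_›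

/-- The reduction at `v` of a model smooth of relative dimension `n` is smooth of relative
dimension `n` over `κ(v)` (base change; Hartshorne III.10.1(b); Stacks 01VB). [folklore] -/
instance smooth_reductionAt (n : ℕ) [SmoothOfRelativeDimension n 𝒳.total.hom] :
    SmoothOfRelativeDimension n 𝒳.reductionAt.hom :=
  haveI := smoothOfRelativeDimension_isStableUnderBaseChange (n := n)
  MorphismProperty.baseChange_obj _ _ ‹_›

/-- The reduction at `v` of a smooth proper model of relative dimension `n` is smooth of relative
dimension `n` and proper over `κ(v)` (Serre–Tate 1968, §1). [cite: SerreTate1968, §1] -/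
theorem IsSmoothProper.reductionAt {n : ℕ} (h : 𝒳.IsSmoothProper n) :
    SmoothOfRelativeDimension n 𝒳.reductionAt.hom ∧ IsProper 𝒳.reductionAt.hom :=
  haveI := h.1; haveI := h.2; ⟨inferInstance, inferInstance⟩

/-- If `X` is a smooth projective (geometrically irreducible) variety over `K` and `𝒳` is a smooth
proper model of `X` over `𝓞_{K,v}`, then the reduction `𝒳 ×_{𝓞_{K,v}} κ(v)` is geometrically
irreducible: by Zariski's connectedness theorem / Stein factorisation the number of geometric
connected components of the fibres of a proper smooth morphism is locally constant, and a smooth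
geometrically connected scheme over a field is geometrically irreducible
(EGA III₁ 4.3.1, EGA IV₃ 15.5.4; Stacks 0E0N, 056T; SGA 1 X 1.2). [cite: StacksProject, Tags 0E0N and 056T (Stein factorisation; smooth + geometrically connected ⇒ geometrically irreducible)] -/
def geometricallyIrreducible_reductionAt : Prop :=
  ∀ {n : ℕ} (hX : IsSmoothProjective n X) (h : 𝒳.IsSmoothProper n),
    GeometricallyIrreducible 𝒳.reductionAt.hom

end IntegralModel

/-! ### Good reduction -/

variable (X : SchemeOver K) (n : ℕ)

/-- `X` has *good reduction at the finite place `v`* (in relative dimension `n`): there is an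
integral model of `X` over the local ring `𝓞_{K,v} = valuationSubringAtPrime K v` which is smooth
of relative dimension `n` and proper (Serre–Tate 1968, §1; SGA 1 X). [cite: SerreTate1968, §1] -/
def HasGoodReductionAt (v : HeightOneSpectrum (𝓞 K)) : Prop :=
  ∃ 𝒳 : IntegralModel (valuationSubringAtPrime K v) K X, 𝒳.IsSmoothProper n

/-- `X` has *good reduction outside `S`*: it has good reduction at every finite place `v ∉ S`
(Serre–Tate 1968, §1). [cite: SerreTate1968, §1] -/
def HasGoodReductionOutside (S : Set (HeightOneSpectrum (𝓞 K))) : Prop :=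
  ∀ v ∉ S, HasGoodReductionAt X n v

variable {X n} in
/-- Good reduction outside `S` is monotone in `S`. [folklore] -/
theorem HasGoodReductionOutside.mono {S T : Set (HeightOneSpectrum (𝓞 K))} (hST : S ⊆ T)
    (h : HasGoodReductionOutside X n S) : HasGoodReductionOutside X n T :=
  fun v hv ↦ h v fun hv' ↦ hv (hST hv')

/-- `X` has *potential good reduction at `v`*: there is a finite extension `L/K` (a number field
`L` with `Algebra K L`) such that the base change `X_L` has good reduction at every finite place
`w` of `L` lying above `v` (Serre–Tate 1968, §1–§2). [cite: SerreTate1968, §1–§2] -/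
def HasPotentialGoodReductionAt (v : HeightOneSpectrum (𝓞 K)) : Prop :=
  ∃ (L : Type) (_ : Field L) (_ : NumberField L) (_ : Algebra K L),
    ∀ w : HeightOneSpectrum (𝓞 L), w.asIdeal.LiesOver v.asIdeal →
      HasGoodReductionAt ((baseChange K L).obj X) n w

variable {X n} in
/-- Good reduction at `v` implies potential good reduction at `v` (take `L = K`: the only place
of `K` above `v` is `v`, and `X_K ≅ X`; Serre–Tate 1968, §1). [cite: SerreTate1968, §1] -/
def HasGoodReductionAt.hasPotentialGoodReductionAt : Prop :=
  ∀ {v : HeightOneSpectrum (𝓞 K)} (h : HasGoodReductionAt X n v),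
    HasPotentialGoodReductionAt X n v

variable {X n} in
/-- **Spreading out.** A smooth projective variety over a number field has good reduction outside
a finite set of finite places: `X → Spec K` spreads out to a smooth projective (hence proper)
scheme over `Spec (𝓞 K)[1/N]` for some `N`, whose localisations are smooth proper models
(EGA IV₃ 8.10.5(v),(xii),(xiii) and IV₄ 17.7.8; Stacks 01ZM, 0C0C, 081F; cf. Mathlib
`AlgebraicGeometry/SpreadingOut.lean`). [cite: StacksProject, Tags 01ZM, 0C0C and 081F (spreading out / limits of schemes)] -/
def exists_finite_hasGoodReductionOutside : Prop :=
  ∀ (hX : IsSmoothProjective n X),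
    ∃ S : Set (HeightOneSpectrum (𝓞 K)), S.Finite ∧ HasGoodReductionOutside X n S

end NumberField

end Literature.AlgebraicGeometry.Motives

end
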